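import Summits.KontsevichZagierPeriods.KontsevichZagierPeriods.Theses.FurushoPentagon
import Summits.KontsevichZagierPeriods.KontsevichZagierPeriods.Theses.HermiteRigidity
import Summits.KontsevichZagierPeriods.KontsevichZagierPeriods.Theorems.HermiteRigidityReductionRigidityOfCubes
import Summits.KontsevichZagierPeriods.KontsevichZagierPeriods.Theorems.HermiteRigidityReductionRigidityFrame
import Summits.KontsevichZagierPeriods.KontsevichZagierPeriods.Theorems.FurushoPentagonStuffleInKZ
import Summits.KontsevichZagierPeriods.KontsevichZagierPeriods.Theorems.FurushoPentagonHoffmanRelationInKZ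
import Summits.KontsevichZagierPeriods.KontsevichZagierPeriods.Theorems.SectorToKernel.Negative.Anatomy
import Literature.NumberTheory.Transcendental.PeriodConjecture

/-!
# `SectorToKernel` (stmt-KontsevichZagierPeriods-10813) by name: the crux is the summit, and it is the conjunction target of two items

Crux `FurushoPentagon.SectorToKernel` of route `KontsevichZagierPeriods/FurushoPentagon` is
`StuffleInKZ → HoffmanRelationInKZ → ∀ c, KZ.eval c = 0 → c ∈ KZ.relations`. This file records, as
kernel-checked statements BY NAME (no hypothesis left as a free variable where the tree proves it):

* `hyps_hold` — both antecedents are tree theorems (`StuffleInKZ.StuffleInKZ_of`, stmt-3931;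
  `HoffmanRelationInKZ.hoffmanRelationInKZ_proof`, stmt-3930), hence
* `sectorToKernel_iff_kernelForm` / `sectorToKernel_iff_kzKernelConjecture` /
  `sectorToKernel_iff_kontsevichZagierPeriods` — the crux IS the kernel form of Kontsevich–Zagier's
  Conjecture 1, i.e. the conjecture leaf `KZKernelConjecture`, i.e. the summit `KontsevichZagierPeriods`,
  UNCONDITIONALLY (the tree so far had the `_of_hyps` forms, `Theorems/SectorToKernel/Negative/Anatomy.lean`);
* `sectorToKernel_iff_reductionRigidity` — it is the same statement as the rank-0 target
  `HermiteRigidity.ReductionRigidity` of route HermiteRigidity (stmt-3407);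
* `sectorToKernel_of_cubeResolution_of_ayoubEffectiveCubeKernel` — line `effective-cube-surjection`
  closes it from the two EXISTING items that are its two open registered stubs, by name:
  stmt-17978 `HermiteRigidity.CubeResolution` (S1, theorem-grade: cubical resolution inside the rules)
  and stmt-18116 `HermiteRigidity.AyoubEffectiveCubeKernel` (S6, the leaf: J. Ayoub, Ann. of Math. 181
  (2015) Conj. 1.1 at `k = ℚ`), through the landed composition `kernelForm_of_cubes`
  (`Theorems/HermiteRigidityReductionRigidityOfCubes.lean`; seam = `Theorems/FurushoPentagonSectorToKernelOfLeaves.lean`);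
* `kontsevichZagierPeriods_of_cubeResolution_of_ayoubEffectiveCubeKernel` — the same two items give
  Conjecture 1 for the calculus of `KZCalculus.lean` (one direction of Ayoub's remark that Conj. 1.1 is a
  reformulation of the period conjecture, made kernel-checkable over the hub's items).

References: M. Kontsevich, D. Zagier, *Periods* (2001), §1.2, Conjecture 1; J. Ayoub, Ann. of Math. 181
(2015), Conj. 1.1, §1.1; J. Ayoub, EMS Newsl. 91 (2014), Rem. 12–13; A. Huber, S. Müller-Stach,
*Periods and Nori Motives* (2017), §13.1.
-/

namespace Summit.KontsevichZagierPeriods.FurushoPentagon.SectorToKernel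

open Literature.NumberTheory.Transcendental
open Summit.KontsevichZagierPeriods.KontsevichZagierPeriods.Theses.FurushoPentagon

/-- **Both antecedents of the crux are theorems**: the stuffle products and Hoffman's relations of the
simplex classes lie in `KZ.relations`. [Hoffman 1992, Thm. 5.1; Kontsevich–Zagier 2001, §1.2] -/
theorem hyps_hold : StuffleInKZ ∧ HoffmanRelationInKZ :=
  ⟨Summit.KontsevichZagierPeriods.FurushoPentagon.StuffleInKZ.StuffleInKZ_of,
    Summit.KontsevichZagierPeriods.FurushoPentagon.HoffmanRelationInKZ.hoffmanRelationInKZ_proof⟩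

/-- **The crux is the kernel form of Conjecture 1, unconditionally**: `SectorToKernel` holds iff every
formal `ℤ`-combination of integral representations of value `0` lies in `KZ.relations`.
[Kontsevich–Zagier 2001, §1.2, Conjecture 1] -/
theorem sectorToKernel_iff_kernelForm :
    SectorToKernel ↔ ∀ c : Literature.NumberTheory.Transcendental.KZ.FormalRep, Literature.NumberTheory.Transcendental.KZ.eval c = 0 → c ∈ Literature.NumberTheory.Transcendental.KZ.relations :=
  ⟨fun h => h hyps_hold.1 hyps_hold.2, fun h _ _ => h⟩

/-- The crux is the tree's conjecture leaf `KZKernelConjecture` (kernel form of Conjecture 1).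
[Kontsevich–Zagier 2001, §1.2, Conjecture 1] -/
theorem sectorToKernel_iff_kzKernelConjecture : SectorToKernel ↔ KZKernelConjecture :=
  sectorToKernel_iff_kernelForm

/-- **The crux is the summit, unconditionally**: `SectorToKernel ↔ KontsevichZagierPeriods`.
[Kontsevich–Zagier 2001, §1.2, Conjecture 1] -/
theorem sectorToKernel_iff_kontsevichZagierPeriods : SectorToKernel ↔ _root_.KontsevichZagierPeriods :=
  Summit.KontsevichZagierPeriods.SectorToKernel.Negative.sectorToKernel_iff_summit_of_hyps
    hyps_hold.1 hyps_hold.2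

/-- The crux is the same statement as route HermiteRigidity's rank-0 target `ReductionRigidity`
(REDUCTION + RIGIDITY over the real algebraic numbers). [Kontsevich–Zagier 2001, §1.2; Huber–Müller-Stach 2017, §13.1] -/
theorem sectorToKernel_iff_reductionRigidity :
    SectorToKernel ↔ Summit.KontsevichZagierPeriods.KontsevichZagierPeriods.Theses.HermiteRigidity.ReductionRigidity :=
  sectorToKernel_iff_kontsevichZagierPeriods.trans
    Summit.KontsevichZagierPeriods.HermiteRigidity.ReductionRigidity.reductionRigidity_iff_kontsevichZagierPeriods.symm

/-- **Line `effective-cube-surjection`, by name**: the cubical resolution of the calculus (item stmt-17978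
`HermiteRigidity.CubeResolution`) together with Ayoub's effective cube conjecture at `k = ℚ` (item
stmt-18116 `HermiteRigidity.AyoubEffectiveCubeKernel`) implies the crux. [Ayoub 2015, Conj. 1.1; Ayoub 2014, Rem. 12–13] -/
theorem sectorToKernel_of_cubeResolution_of_ayoubEffectiveCubeKernel :
    Summit.KontsevichZagierPeriods.KontsevichZagierPeriods.Theses.HermiteRigidity.CubeResolution → Summit.KontsevichZagierPeriods.KontsevichZagierPeriods.Theses.HermiteRigidity.AyoubEffectiveCubeKernel → SectorToKernel :=
  fun h1 h6 _ _ =>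
    Summit.KontsevichZagierPeriods.HermiteRigidity.ReductionRigidityOfCubes.kernelForm_of_cubes h1 h6

/-- **Ayoub's effective cube conjecture and the cubical resolution of the calculus imply
Kontsevich–Zagier's Conjecture 1** (for the calculus of `KZCalculus.lean`), over the hub's two items by
name. [Ayoub 2015, Conj. 1.1 and §1.1; Kontsevich–Zagier 2001, §1.2, Conjecture 1] -/
theorem kontsevichZagierPeriods_of_cubeResolution_of_ayoubEffectiveCubeKernel :
    Summit.KontsevichZagierPeriods.KontsevichZagierPeriods.Theses.HermiteRigidity.CubeResolution → Summit.KontsevichZagierPeriods.KontsevichZagierPeriods.Theses.HermiteRigidity.AyoubEffectiveCubeKernel → _root_.KontsevichZagierPeriods :=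
  fun h1 h6 =>
    sectorToKernel_iff_kontsevichZagierPeriods.mp
      (sectorToKernel_of_cubeResolution_of_ayoubEffectiveCubeKernel h1 h6)

end Summit.KontsevichZagierPeriods.FurushoPentagon.SectorToKernel
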